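import Summits.HubbardSuperconductivity.HubbardSuperconductivity.Theorems.AnisotropyChordTransferFibre3TwoHoleBSNearWindowAllLClasses
import Summits.HubbardSuperconductivity.HubbardSuperconductivity.Theorems.AnisotropyChordTransferFibre3TwoHoleBSCovariance

/-!
# Route `AnisotropyChord` / H0 rotor rung: ★★★ HOLE₂(.75) for EVERY near pair with disjoint crosses and EVERY `L ≥ 8192` — the `D₄` orbits

Twenty-first file of the `TwoHoleBS` (PROP BS) chain: the `D₄` images of the six class theorems
`…NearWindowAllLClasses.dualCert_near_window_<d>_allL` by the covariances of `…TwoHoleBSCovariance` (`dualCert_mirror`,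
`dualCert_neg`, `dualCert_swap`, applied to the all-`z` statements):
* `allz_mirror`, `allz_neg`, `allz_swap` (transport of `∀ z, DualCert L g z (z + d)` to `(−d₁,d₂)`, `−d`, `(d₂,d₁)`);
* ★★★ `hole2_near_disjoint_allL`: **for every `L ≥ 8192`, every `z`, and every integer offset `d` with `|d₁|, |d₂| ≤ 3` and
  `|d₁| + |d₂| ≥ 3` (the 36 near offsets whose crosses are disjoint), `DualCert L (¾ε₁) z (z + d)`** — unconditional.
Prover seat `hubbard-h0-rotor-p2` g3; helper for stmt-HubbardSuperconductivity-19089 (`--supports`, helper class).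
WHAT THIS IS NOT: nothing here proves superconductivity in the Hubbard model; the rotor TARGET as originally worded stays
FALSE (g15 verdict).  `TwoHoleGap L (¾ε₁)` (HOLE₂(.75), the hypothesis of `gm3_of_hole2`) needs EVERY pair class: the
overlapping-cross offsets `|d|₁ ≤ 2`, the far offsets `|d|∞ ≥ 4` (up to `L/2`) and the sides `37 ≤ L < 8192` remain open in the tree.
Mathlib + tree imports only; no sorry, no axioms.
-/

set_option linter.dupNamespace false
set_option autoImplicit false

namespace Summit.HubbardSuperconductivity.HubbardSuperconductivity.Theorems.AnisotropyChord.Transfer.Fibre3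

namespace TwoHoleBS

variable (L : ℕ) [NeZero L]

/-- transport of an all-`z` certificate to the mirrored offset `(−d₁, d₂)`. [folklore] -/
theorem allz_mirror {g : ℝ} {a b : ℤ} (h : ∀ z : Tor L, DualCert L g z (z + castPt L (a, b))) (z : Tor L) :
    DualCert L g z (z + castPt L (-a, b)) := by
  have key := dualCert_mirror L (h (-z.1, z.2))
  have e1 : ((-((-z.1, z.2) : Tor L).1, ((-z.1, z.2) : Tor L).2) : Tor L) = z := Prod.ext (neg_neg _) rfl
  have e2 : ((-(((-z.1, z.2) : Tor L) + castPt L (a, b)).1, (((-z.1, z.2) : Tor L) + castPt L (a, b)).2) : Tor L)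
      = z + castPt L (-a, b) := by
    refine Prod.ext ?_ rfl
    show -(-z.1 + ((a : ℤ) : ZMod L)) = z.1 + (((-a : ℤ)) : ZMod L)
    push_cast; ring
  rw [e1, e2] at key
  exact key

/-- transport of an all-`z` certificate to the negated offset `−d`. [folklore] -/
theorem allz_neg {g : ℝ} {a b : ℤ} (h : ∀ z : Tor L, DualCert L g z (z + castPt L (a, b))) (z : Tor L) :
    DualCert L g z (z + castPt L (-a, -b)) := by
  have key := dualCert_neg L (h (-z))
  have e1 : -(-z) = z := neg_neg z
  have e2 : -(-z + castPt L (a, b)) = z + castPt L (-a, -b) := by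
    refine Prod.ext ?_ ?_
    · show -(-z.1 + ((a : ℤ) : ZMod L)) = z.1 + (((-a : ℤ)) : ZMod L)
      push_cast; ring
    · show -(-z.2 + ((b : ℤ) : ZMod L)) = z.2 + (((-b : ℤ)) : ZMod L)
      push_cast; ring
  rw [e1, e2] at key
  exact key

/-- transport of an all-`z` certificate to the swapped offset `(d₂, d₁)`. [folklore] -/
theorem allz_swap {g : ℝ} {a b : ℤ} (h : ∀ z : Tor L, DualCert L g z (z + castPt L (a, b))) (z : Tor L) :
    DualCert L g z (z + castPt L (b, a)) := by
  have key := dualCert_swap L (h (z.2, z.1))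
  have e1 : ((((z.2, z.1) : Tor L).2, ((z.2, z.1) : Tor L).1) : Tor L) = z := Prod.ext rfl rfl
  have e2 : (((((z.2, z.1) : Tor L) + castPt L (a, b)).2, (((z.2, z.1) : Tor L) + castPt L (a, b)).1) : Tor L)
      = z + castPt L (b, a) := Prod.ext rfl rfl
  rw [e1, e2] at key
  exact key

/-- ★★★ **HOLE₂(.75), ALL NEAR PAIRS WITH DISJOINT CROSSES, ALL `L ≥ 8192`:** for `|d₁|, |d₂| ≤ 3`, `|d₁| + |d₂| ≥ 3`, every `z`:
`DualCert L (¾ε₁) z (z + d)`. [folklore] -/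
theorem hole2_near_disjoint_allL (hL : 8192 ≤ L) (a b : ℤ) (ha : |a| ≤ 3) (hb : |b| ≤ 3) (hab : 3 ≤ |a| + |b|)
    (z : Tor L) : DualCert L (3 / 4 * eps1 L) z (z + castPt L (a, b)) := by
  have h21 : ∀ z : Tor L, DualCert L (3 / 4 * eps1 L) z (z + castPt L (2, 1)) := fun z => dualCert_near_window_2_1_allL L hL z
  have h30 : ∀ z : Tor L, DualCert L (3 / 4 * eps1 L) z (z + castPt L (3, 0)) := fun z => dualCert_near_window_3_0_allL L hL z
  have h22 : ∀ z : Tor L, DualCert L (3 / 4 * eps1 L) z (z + castPt L (2, 2)) := fun z => dualCert_near_window_2_2_allL L hL z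
  have h31 : ∀ z : Tor L, DualCert L (3 / 4 * eps1 L) z (z + castPt L (3, 1)) := fun z => dualCert_near_window_3_1_allL L hL z
  have h32 : ∀ z : Tor L, DualCert L (3 / 4 * eps1 L) z (z + castPt L (3, 2)) := fun z => dualCert_near_window_3_2_allL L hL z
  have h33 : ∀ z : Tor L, DualCert L (3 / 4 * eps1 L) z (z + castPt L (3, 3)) := fun z => dualCert_near_window_3_3_allL L hL z
  have ha' : -3 ≤ a ∧ a ≤ 3 := abs_le.mp ha
  have hb' : -3 ≤ b ∧ b ≤ 3 := abs_le.mp hb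
  obtain ⟨ha1, ha2⟩ := ha'
  obtain ⟨hb1, hb2⟩ := hb'
  interval_cases a <;> interval_cases b <;> first
    | (exfalso; norm_num at hab; done)
    | exact h21 z
    | exact (allz_mirror L h21) z
    | exact (allz_neg L h21) z
    | exact (allz_swap L h21) z
    | exact (allz_neg L (allz_mirror L h21)) z
    | exact (allz_swap L (allz_mirror L h21)) z
    | exact (allz_swap L (allz_neg L h21)) z
    | exact (allz_mirror L (allz_swap L h21)) z
    | exact h30 z
    | exact (allz_mirror L h30) z
    | exact (allz_swap L h30) z
    | exact (allz_swap L (allz_mirror L h30)) z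
    | exact h22 z
    | exact (allz_mirror L h22) z
    | exact (allz_neg L h22) z
    | exact (allz_neg L (allz_mirror L h22)) z
    | exact h31 z
    | exact (allz_mirror L h31) z
    | exact (allz_neg L h31) z
    | exact (allz_swap L h31) z
    | exact (allz_neg L (allz_mirror L h31)) z
    | exact (allz_swap L (allz_mirror L h31)) z
    | exact (allz_swap L (allz_neg L h31)) z
    | exact (allz_mirror L (allz_swap L h31)) z
    | exact h32 z
    | exact (allz_mirror L h32) z
    | exact (allz_neg L h32) z
    | exact (allz_swap L h32) z
    | exact (allz_neg L (allz_mirror L h32)) z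
    | exact (allz_swap L (allz_mirror L h32)) z
    | exact (allz_swap L (allz_neg L h32)) z
    | exact (allz_mirror L (allz_swap L h32)) z
    | exact h33 z
    | exact (allz_mirror L h33) z
    | exact (allz_neg L h33) z
    | exact (allz_neg L (allz_mirror L h33)) z

end TwoHoleBS

end Summit.HubbardSuperconductivity.HubbardSuperconductivity.Theorems.AnisotropyChord.Transfer.Fibre3
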